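import Summits.ResolutionOfSingularities.ResolutionOfSingularities.Theorems.EquisingularLiftEquisingularLiftNatSpecimenQuarticTcDeltaLocalCharts
import Literature.AlgebraicGeometry.Resolution.NormalCrossingsLocal
import Summits.ResolutionOfSingularities.ResolutionOfSingularities.Theorems.EquisingularLiftEquisingularLiftNatSpecimenQuarticForms
import Summits.ResolutionOfSingularities.ResolutionOfSingularities.Theorems.EquisingularLiftEquisingularLiftNatSpecimenQuarticSingularLocus
import Summits.ResolutionOfSingularities.ResolutionOfSingularities.Theorems.EquisingularLiftEquisingularLiftNatSpecimenQuarticPointStepSwap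
import Literature.AlgebraicGeometry.Motives.ProjectiveSpaceCells
import Literature.AlgebraicGeometry.Motives.ProjectiveSpaceLinearSubspaceSection
import Mathlib.Topology.JacobsonSpace
import Literature.AlgebraicGeometry.Resolution.ProjectiveStrongResolution
import Literature.AlgebraicGeometry.Resolution.ComponentGluing
import HarnessLib

/-!
# [OURS · L1 W4.5(b) · EL♮(3)] SPECIMEN-Q DOWNSTAIRS, part S — STAGE-0 DATA of the quartic `H = V(x₀²x₃² + x₁⁴ + x₂⁴) ⊂ ℙ³_k` at its two
# singular points `[1:0:0:0]`, `[0:0:0:1]` through the standard charts (crux `EquisingularLiftNatThree` = stmt-ResolutionOfSingularities-20148,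
# line `sections3`; res-L1-w45b-lead-2 CUT 2026-08-27T08:41:07Z «SPECIMEN-Q DOWNSTAIRS» to res-D-pv-034 AS res-L1-s36-pv-3; helper, closes nothing)

HONEST FRAMING. OURS (cell `res-hironaka`, chain w45b, slot W4.5(b)); NOT a statement of any manuscript; AI-written, weaker than
expert review. The (P)/(TC) constructors of the registered stub `stub_elnat_tcDeltaPointResolution` ask, at the point to be blown up:
«`x` a CLOSED point of `V(closure T)_red` at which `V(closure T)_red` is NOT regular and the ambient IS regular». This file supplies these
inputs for the quartic at both singular points, in the chart currency of the engine (`…SpecimenQuarticTcDeltaEngine`):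

* the two open-immersion charts `u0 = chartι 0 : Spec k[X] → ℙ³` (`D₊(x₀)`) and `u3 = (X₀ ↔ X₂) ≫ chartι 3` (`D₊(x₃)`), under BOTH of
  which the quartic reads `z² + x⁴ + y⁴` (`preimage_u0_range_ι`, `preimage_u3_range_ι`; stub-4 `dehomogenize_form_zero/three`,
  `chartAlgEquiv_chartEqn`), and the pull-backs `𝓘_H · 𝒪 = (z² + x⁴ + y⁴)~` (`comap_u0/u3_vanishingIdeal_range`);
* the singular points as images `u(o)` of the origin: closed (`ℙ³` is Jacobson), on `H`, seen by the chart only at the origin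
  (`comap_vanishingIdeal_singleton_chart_o : 𝓘_{u(o)} · 𝒪 = 𝔪₀~`), in different charts (`u3_o_not_mem_range_u0`, `u0_o_not_mem_range_u3`),
  with `ℙ³` regular there (`isRegularLocalRing_stalk_chart_o`);
* `Γ₀ = V(closure ι(H))_red` is integral and NOT regular over `u(o)` (`not_isRegularLocalRing_Γ₀`: the tree's
  `isRegularLocalRing_localization_quotient_of_chart` + stub-4's `not_isRegularLocalRing_origin`).

References: Hartshorne II Prop. 2.5, Ex. 3.2.6; Matsumura Thm. 14.2; Stacks 080E (via the cited tree files).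
-/

set_option linter.dupNamespace false -- mandated namespace `Summit.<Summit>.<Problem>` of this single-conjunct summit

noncomputable section

open CategoryTheory CategoryTheory.Limits AlgebraicGeometry TopologicalSpace
open MvPolynomial
open Literature.AlgebraicGeometry.Resolution
open Literature.AlgebraicGeometry.Motives Literature.AlgebraicGeometry.Motives.SmoothHypersurface
open Literature.AlgebraicGeometry.Motives.ProjectiveSpace
open AlgebraicGeometry.Scheme.IdealSheafData
open Summit.ResolutionOfSingularities.ResolutionOfSingularities.Theorems.EquisingularLift

attribute [local instance] MvPolynomial.gradedAlgebra ProjBaseChange.algebraBase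

namespace Summit.ResolutionOfSingularities.ResolutionOfSingularities.Cruxes.EquisingularLiftNat.Sections

namespace SpecimenQuarticTcDelta

variable (k : Type) [Field k]

/-! ## The ambient `ℙ³`, the quartic, the two standard charts at the singular points -/

/-- `ℙ³_k` (the item's `(projectiveSpace 3 k).left`, spelled as `Proj`). [folklore] -/
abbrev P3 : Scheme.{0} := Proj (MvPolynomial.homogeneousSubmodule (Fin (3 + 1)) k)

/-- The quartic `H` and its closed immersion `ι : H → ℙ³` (stub-4's `SpecimenQuartic.form`). [folklore] -/
abbrev ιQ : (hypersurface (SpecimenQuartic.form k)).left ⟶ P3 k := (hypersurfaceι (SpecimenQuartic.form k)).left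

/-- `ι : H ↪ ℙ³` is a closed immersion (explicit instance through the abbreviation `ιQ`). [folklore] -/
instance isClosedImmersion_ιQ : IsClosedImmersion (ιQ k) :=
  SmoothHypersurface.isClosedImmersion_hypersurfaceι_left (SpecimenQuartic.form k)

/-- `q ∈ V(t) ↔ t ∈ q` (bookkeeping across the `Spec`/`PrimeSpectrum` spellings). [folklore] -/
theorem mem_zeroLocus_singleton_iff' {C : Type} [CommRing C] (q : PrimeSpectrum C) (t : C) :
    q ∈ PrimeSpectrum.zeroLocus ({t} : Set C) ↔ t ∈ q.asIdeal := by
  rw [PrimeSpectrum.mem_zeroLocus, Set.singleton_subset_iff, SetLike.mem_coe]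

/-- The origin `𝔪₀ = (X₀, X₁, X₂)` of `Spec k[X₀, X₁, X₂]` as a point. [folklore] -/
def o : Spec (CommRingCat.of (MvPolynomial (Fin 3) k)) :=
  ⟨PointBlowup.originIdeal 2 k, SpecimenQuartic.isPrime_origin k⟩

/-- The chart at `D₊(x₀)` (coordinates `xⱼ/x₀`, `j = 1,2,3`; the quartic reads `fSing = z² + x⁴ + y⁴`). [cite: Hartshorne1977, II Prop. 2.5] -/
abbrev u0 : Spec (CommRingCat.of (MvPolynomial (Fin 3) k)) ⟶ P3 k := ProjectiveSpaceCells.chartι k 3 0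

/-- The coordinate swap `X₀ ↔ X₂` of `k[X₀, X₁, X₂]`. [folklore] -/
abbrev swapHom : MvPolynomial (Fin 3) k →+* MvPolynomial (Fin 3) k :=
  (rename (Equiv.swap (0 : Fin 3) 2) : MvPolynomial (Fin 3) k →ₐ[k] MvPolynomial (Fin 3) k).toRingHom

/-- The chart at `D₊(x₃)` followed by `X₀ ↔ X₂` (so that the quartic again reads `fSing = z² + x⁴ + y⁴`). [cite: Hartshorne1977, II Prop. 2.5] -/
abbrev u3 : Spec (CommRingCat.of (MvPolynomial (Fin 3) k)) ⟶ P3 k :=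
  Spec.map (CommRingCat.ofHom (swapHom k)) ≫ ProjectiveSpaceCells.chartι k 3 3

/-- `X₀ ↔ X₂` is an involution, so `Spec` of it is an isomorphism. [folklore] -/
instance isIso_specMap_swapHom : IsIso (Spec.map (CommRingCat.ofHom (swapHom k))) := by
  have h : swapHom k = (renameEquiv k (Equiv.swap (0 : Fin 3) 2)).toRingEquiv.toRingHom := rfl
  rw [h]
  change IsIso (Scheme.Spec.mapIso (renameEquiv k (Equiv.swap (0 : Fin 3) 2)).toRingEquiv.toCommRingCatIso.op).inv
  infer_instance

/-- `u3` is an open immersion (composite of an isomorphism and the standard chart). [folklore] -/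
instance isOpenImmersion_u3 : IsOpenImmersion (u3 k) := inferInstance

/-! ## The quartic on the charts: `u⁻¹ H = V(z² + x⁴ + y⁴)` -/

/-- `u_c⁻¹ V₊(F) = V(F(x_c := 1))` for the standard chart. [folklore] -/
theorem preimage_chartι_range_ι (c : Fin 4) :
    (ProjectiveSpaceCells.chartι k 3 c) ⁻¹' Set.range (ιQ k) =
      PrimeSpectrum.zeroLocus {dehomogenize k c (SpecimenQuartic.form k)} := by
  erw [range_hypersurfaceι]
  rw [ProjectiveSpaceCells.chartι, Scheme.Hom.comp_base, TopCat.coe_comp, Set.preimage_comp,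
    ProjSubscheme.awayι_preimage_zeroLocus _ (ProjectiveSpace.X_mem c) zero_lt_one
      ((mem_homogeneousSubmodule 4 _).mpr (SpecimenQuartic.isHomogeneous_form k)) (by norm_num)]
  change PrimeSpectrum.comap (ProjectiveSpace.chartAlgEquiv k c).toRingEquiv.toRingHom ⁻¹' _ = _
  rw [PrimeSpectrum.preimage_comap_zeroLocus, Set.image_singleton]
  exact congrArg _ (congrArg _ (SpecimenQuartic.chartAlgEquiv_chartEqn k c))

/-- **`u₀⁻¹ H = V(z² + x⁴ + y⁴)`.** [folklore] -/
theorem preimage_u0_range_ι :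
    (u0 k) ⁻¹' Set.range (ιQ k) = PrimeSpectrum.zeroLocus {(X 2 ^ 2 + X 0 ^ 4 + X 1 ^ 4 : MvPolynomial (Fin 3) k)} := by
  rw [u0, preimage_chartι_range_ι, SpecimenQuartic.dehomogenize_form_zero]
  rfl

/-- **`u₃⁻¹ H = V(z² + x⁴ + y⁴)`** (after the swap). [folklore] -/
theorem preimage_u3_range_ι :
    (u3 k) ⁻¹' Set.range (ιQ k) = PrimeSpectrum.zeroLocus {(X 2 ^ 2 + X 0 ^ 4 + X 1 ^ 4 : MvPolynomial (Fin 3) k)} := by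
  rw [u3, Scheme.Hom.comp_base, TopCat.coe_comp, Set.preimage_comp]
  change _ ⁻¹' ((ProjectiveSpaceCells.chartι k 3 3) ⁻¹' Set.range (ιQ k)) = _
  rw [preimage_chartι_range_ι, SpecimenQuartic.dehomogenize_form_three]
  change PrimeSpectrum.comap (swapHom k) ⁻¹' _ = _
  rw [PrimeSpectrum.preimage_comap_zeroLocus, Set.image_singleton]
  refine congrArg _ (congrArg _ ?_)
  change rename (Equiv.swap (0 : Fin 3) 2) (SpecimenQuartic.fSing' k) = _
  rw [SpecimenQuartic.fSing'_eq_rename, rename_rename]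
  have : (Equiv.swap (0 : Fin 3) 2) ∘ (Equiv.swap (0 : Fin 3) 2) = id := by
    funext i; simp [Equiv.swap_apply_self]
  rw [this, rename_id]
  rfl


/-! ## The ideal sheaf of `H` pulls back to `(z² + x⁴ + y⁴)~` along both charts -/

/-- `H = ι(H)` is closed in `ℙ³`. [folklore] -/
theorem isClosed_range_ι : IsClosed (Set.range (ιQ k)) := (ιQ k).isClosedEmbedding.isClosed_range

/-- The pull-back computation, for a chart with `u⁻¹ H = V(f)` and `(f)` radical. [folklore] -/
theorem comap_vanishingIdeal_range_of_preimage {u : Spec (CommRingCat.of (MvPolynomial (Fin 3) k)) ⟶ P3 k} [IsOpenImmersion u]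
    {f : MvPolynomial (Fin 3) k} (hu : u ⁻¹' Set.range (ιQ k) = PrimeSpectrum.zeroLocus {f})
    (hrad : (Ideal.span {f}).radical = Ideal.span {f}) :
    (vanishingIdeal (⟨Set.range (ιQ k), isClosed_range_ι k⟩ : Closeds (P3 k))).comap u =
      ofIdealTop ((Ideal.span {f}).map (Scheme.ΓSpecIso (CommRingCat.of (MvPolynomial (Fin 3) k))).inv.hom) := by
  rw [comap_vanishingIdeal_of_isOpenImmersion]
  have h : (Closeds.preimage (⟨Set.range (ιQ k), isClosed_range_ι k⟩ : Closeds (P3 k)) u.continuous) =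
      ⟨PrimeSpectrum.zeroLocus {f}, PrimeSpectrum.isClosed_zeroLocus _⟩ := Closeds.ext hu
  rw [h, vanishingIdeal_zeroLocus_Spec, hrad]

/-- **`𝓘_H · 𝒪 = (z² + x⁴ + y⁴)~` on the chart `u₀`** (`k = k̄`, `char k ≠ 2`). [folklore] -/
theorem comap_u0_vanishingIdeal_range [IsAlgClosed k] (h2 : (2 : k) ≠ 0) :
    (vanishingIdeal (⟨Set.range (ιQ k), isClosed_range_ι k⟩ : Closeds (P3 k))).comap (u0 k) =
      ofIdealTop ((Ideal.span {(X 2 ^ 2 + X 0 ^ 4 + X 1 ^ 4 : MvPolynomial (Fin 3) k)}).map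
        (Scheme.ΓSpecIso (CommRingCat.of (MvPolynomial (Fin 3) k))).inv.hom) :=
  comap_vanishingIdeal_range_of_preimage k (preimage_u0_range_ι k) (SpecimenQuartic.radical_span_fSing k h2)

/-- **`𝓘_H · 𝒪 = (z² + x⁴ + y⁴)~` on the chart `u₃`.** [folklore] -/
theorem comap_u3_vanishingIdeal_range [IsAlgClosed k] (h2 : (2 : k) ≠ 0) :
    (vanishingIdeal (⟨Set.range (ιQ k), isClosed_range_ι k⟩ : Closeds (P3 k))).comap (u3 k) =
      ofIdealTop ((Ideal.span {(X 2 ^ 2 + X 0 ^ 4 + X 1 ^ 4 : MvPolynomial (Fin 3) k)}).map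
        (Scheme.ΓSpecIso (CommRingCat.of (MvPolynomial (Fin 3) k))).inv.hom) :=
  comap_vanishingIdeal_range_of_preimage k (preimage_u3_range_ι k) (SpecimenQuartic.radical_span_fSing k h2)

/-! ## The two singular points as images of the chart origins -/

/-- `ℙ³_k` is a Jacobson space (locally of finite type over `k`). [folklore] -/
theorem jacobsonSpace_P3 : JacobsonSpace (P3 k) :=
  @LocallyOfFiniteType.jacobsonSpace (P3 k) (Spec (CommRingCat.of k)) (projectiveSpace 3 k).hom
    (ProjSpace.locallyOfFiniteType_projectiveSpace_hom (N := 3) (K := k)) inferInstance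

/-- The origin is a closed point of `Spec k[X]`. [folklore] -/
theorem isClosed_singleton_o : IsClosed ({o k} : Set (Spec (CommRingCat.of (MvPolynomial (Fin 3) k)))) := by
  exact (PrimeSpectrum.isClosed_singleton_iff_isMaximal (o k)).mpr (isMaximal_originIdeal k)

/-- The image of the origin under an open-immersion chart is a closed point of `ℙ³`. [folklore] -/
theorem isClosed_singleton_chart_o (u : Spec (CommRingCat.of (MvPolynomial (Fin 3) k)) ⟶ P3 k) [IsOpenImmersion u] :
    IsClosed ({u (o k)} : Set (P3 k)) := by
  haveI := jacobsonSpace_P3 k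
  have h := u.isOpenEmbedding.preimage_closedPoints (Y := P3 k)
  have ho : o k ∈ u ⁻¹' closedPoints (P3 k) := by
    rw [h]; exact isClosed_singleton_o k
  exact ho

/-- `f = z² + x⁴ + y⁴ ∈ 𝔪₀`: the origin lies on `V(f)`. [folklore] -/
theorem o_mem_zeroLocus : o k ∈ PrimeSpectrum.zeroLocus {(X 2 ^ 2 + X 0 ^ 4 + X 1 ^ 4 : MvPolynomial (Fin 3) k)} :=
  (mem_zeroLocus_singleton_iff' (o k) _).mpr (fQ_mem_originIdeal k)

/-- The chart points lie on `H`. [folklore] -/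
theorem chart_o_mem_range {u : Spec (CommRingCat.of (MvPolynomial (Fin 3) k)) ⟶ P3 k}
    (hu : u ⁻¹' Set.range (ιQ k) = PrimeSpectrum.zeroLocus {(X 2 ^ 2 + X 0 ^ 4 + X 1 ^ 4 : MvPolynomial (Fin 3) k)}) :
    u (o k) ∈ Set.range (ιQ k) := by
  have h : o k ∈ u ⁻¹' Set.range (ιQ k) := by rw [hu]; exact o_mem_zeroLocus k
  exact h

/-- An open immersion sees only the origin over its image. [folklore] -/
theorem preimage_singleton_chart_o (u : Spec (CommRingCat.of (MvPolynomial (Fin 3) k)) ⟶ P3 k) [IsOpenImmersion u] :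
    u ⁻¹' {u (o k)} = {o k} := by
  ext q
  simp only [Set.mem_preimage, Set.mem_singleton_iff]
  exact u.isOpenEmbedding.injective.eq_iff

/-- `{𝔪₀} = V(𝔪₀)`. [folklore] -/
theorem singleton_o_eq_zeroLocus :
    ({o k} : Set (Spec (CommRingCat.of (MvPolynomial (Fin 3) k)))) = PrimeSpectrum.zeroLocus (PointBlowup.originIdeal 2 k) := by
  ext q
  rw [Set.mem_singleton_iff]
  constructor
  · rintro rfl
    exact (PrimeSpectrum.mem_zeroLocus _ _).mpr le_rfl
  · intro hq
    have hle : PointBlowup.originIdeal 2 k ≤ q.asIdeal := (PrimeSpectrum.mem_zeroLocus _ _).mp hq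
    apply PrimeSpectrum.ext
    exact ((isMaximal_originIdeal k).eq_of_le q.isPrime.ne_top hle).symm

/-- **`𝓘_{u(o)} · 𝒪 = 𝔪₀~` on an open-immersion chart `u`.** [folklore] -/
theorem comap_vanishingIdeal_singleton_chart_o (u : Spec (CommRingCat.of (MvPolynomial (Fin 3) k)) ⟶ P3 k) [IsOpenImmersion u] :
    (vanishingIdeal (⟨{u (o k)}, isClosed_singleton_chart_o k u⟩ : Closeds (P3 k))).comap u =
      ofIdealTop ((PointBlowup.originIdeal 2 k).map (Scheme.ΓSpecIso (CommRingCat.of (MvPolynomial (Fin 3) k))).inv.hom) := by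
  rw [comap_vanishingIdeal_of_isOpenImmersion]
  have h : (Closeds.preimage (⟨{u (o k)}, isClosed_singleton_chart_o k u⟩ : Closeds (P3 k)) u.continuous) =
      ⟨PrimeSpectrum.zeroLocus (PointBlowup.originIdeal 2 k : Set (MvPolynomial (Fin 3) k)), PrimeSpectrum.isClosed_zeroLocus _⟩ :=
    Closeds.ext ((preimage_singleton_chart_o k u).trans (singleton_o_eq_zeroLocus k))
  rw [h]
  have h2 := vanishingIdeal_zeroLocus_Spec (CommRingCat.of (MvPolynomial (Fin 3) k))
    (PointBlowup.originIdeal 2 k : Set (MvPolynomial (Fin 3) k))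
  rw [Ideal.span_eq, (isMaximal_originIdeal k).isPrime.radical] at h2
  exact h2

/-- **`ℙ³` is regular at the chart points** (the chart is an open immersion from the regular `Spec k[X]`). [folklore] -/
theorem isRegularLocalRing_stalk_chart_o (u : Spec (CommRingCat.of (MvPolynomial (Fin 3) k)) ⟶ P3 k) [IsOpenImmersion u] :
    IsRegularLocalRing ((P3 k).presheaf.stalk (u (o k))) := by
  haveI : IsRegularLocalRing ((Spec (CommRingCat.of (MvPolynomial (Fin 3) k))).presheaf.stalk (o k)) :=
    Scheme.isRegular_Spec (CommRingCat.of (MvPolynomial (Fin 3) k)) (o k)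
  exact IsRegularLocalRing.of_ringEquiv (asIso (u.stalkMap (o k))).commRingCatIsoToRingEquiv.symm

/-! ## The two points miss each other's chart -/

/-- `u₃(o) = [0:0:0:1] ∉ D₊(x₀) = u₀(𝔸³)`. [folklore] -/
theorem u3_o_not_mem_range_u0 : (u3 k) (o k) ∉ Set.range (u0 k) := by
  intro h
  rw [u0, ProjectiveSpaceCells.range_chartι] at h
  -- `x₀` vanishes at `u₃(o)`: `u₃⁻¹ V₊(x₀) ∋ o`
  have hx : (X (0 : Fin 4) : MvPolynomial (Fin 4) k) ∈ ((u3 k) (o k)).asHomogeneousIdeal := by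
    have h3 : ((ProjectiveSpaceCells.chartι k 3 3).base ⁻¹'
        ProjectiveSpectrum.zeroLocus _ {(X ((3 : Fin 4).succAbove 0) : MvPolynomial (Fin (3 + 1)) k)}) =
        PrimeSpectrum.zeroLocus {(X 0 : MvPolynomial (Fin 3) k)} :=
      ProjectiveSpaceCells.chartι_preimage_zeroLocus_X k 3 3 0
    have hmem : Spec.map (CommRingCat.ofHom (swapHom k)) (o k) ∈ (ProjectiveSpaceCells.chartι k 3 3).base ⁻¹'
        ProjectiveSpectrum.zeroLocus _ {(X ((3 : Fin 4).succAbove 0) : MvPolynomial (Fin (3 + 1)) k)} := by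
      rw [h3, Spec.map_apply]
      refine (mem_zeroLocus_singleton_iff' _ _).mpr ?_
      rw [PrimeSpectrum.comap_asIdeal, Ideal.mem_comap]
      change rename (Equiv.swap (0 : Fin 3) 2) (X 0 : MvPolynomial (Fin 3) k) ∈ PointBlowup.originIdeal 2 k
      rw [rename_X, Equiv.swap_apply_left]
      exact Ideal.subset_span (Set.mem_range_self _)
    have := (ProjectiveSpectrum.mem_zeroLocus _ _ _).mp hmem
    exact this (Set.mem_singleton _)
  exact h hx

/-- `u₀(o) = [1:0:0:0] ∉ D₊(x₃) ⊇ u₃(𝔸³)`. [folklore] -/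
theorem u0_o_not_mem_range_u3 : (u0 k) (o k) ∉ Set.range (u3 k) := by
  intro h
  have h' : (u0 k) (o k) ∈ Set.range (ProjectiveSpaceCells.chartι k 3 3) := by
    obtain ⟨q, hq⟩ := h
    exact ⟨_, hq⟩
  rw [ProjectiveSpaceCells.range_chartι] at h'
  have hx : (X (3 : Fin 4) : MvPolynomial (Fin 4) k) ∈ ((u0 k) (o k)).asHomogeneousIdeal := by
    have h0 : ((ProjectiveSpaceCells.chartι k 3 0).base ⁻¹'
        ProjectiveSpectrum.zeroLocus _ {(X ((0 : Fin 4).succAbove 2) : MvPolynomial (Fin (3 + 1)) k)}) =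
        PrimeSpectrum.zeroLocus {(X 2 : MvPolynomial (Fin 3) k)} :=
      ProjectiveSpaceCells.chartι_preimage_zeroLocus_X k 3 0 2
    have hmem : o k ∈ (ProjectiveSpaceCells.chartι k 3 0).base ⁻¹'
        ProjectiveSpectrum.zeroLocus _ {(X ((0 : Fin 4).succAbove 2) : MvPolynomial (Fin (3 + 1)) k)} := by
      rw [h0]
      exact (mem_zeroLocus_singleton_iff' _ _).mpr (Ideal.subset_span (Set.mem_range_self _))
    have := (ProjectiveSpectrum.mem_zeroLocus _ _ _).mp hmem
    exact this (Set.mem_singleton _)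
  exact h' hx


/-! ## The reduced structure `Γ₀ = V(closure ι(H))_red` is NOT regular at the two singular points -/

/-- `closure ι(H) = ι(H)`. [folklore] -/
theorem closure_range_ι : closure (Set.range (ιQ k)) = Set.range (ιQ k) := (isClosed_range_ι k).closure_eq

/-- `ι(H)` is irreducible (`H` is integral, `k = k̄`, `char k ≠ 2`). [folklore] -/
theorem isIrreducible_range_ι [IsAlgClosed k] (h2 : (2 : k) ≠ 0) : IsIrreducible (Set.range (ιQ k)) := by
  haveI := SpecimenQuartic.isIntegral_hypersurface k h2
  rw [← Set.image_univ]
  exact (IrreducibleSpace.isIrreducible_univ _).image _ (ιQ k).continuous.continuousOn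

/-- `Γ₀ = V(closure ι(H))_red` is an integral scheme. [folklore] -/
theorem isIntegral_Γ₀ [IsAlgClosed k] (h2 : (2 : k) ≠ 0) :
    IsIntegral (vanishingIdeal (⟨closure (Set.range (ιQ k)), isClosed_closure⟩ : Closeds (P3 k))).subscheme :=
  ComponentGluing.isIntegral_subscheme_vanishingIdeal _ (by
    change IsIrreducible (closure (Set.range (ιQ k)))
    exact (isIrreducible_range_ι k h2).closure)

/-- A point of `Γ₀` over each chart point `u(o)` (which lies on `ι(H)`). [folklore] -/
theorem exists_point_Γ₀ {u : Spec (CommRingCat.of (MvPolynomial (Fin 3) k)) ⟶ P3 k}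
    (hu : u ⁻¹' Set.range (ιQ k) = PrimeSpectrum.zeroLocus {(X 2 ^ 2 + X 0 ^ 4 + X 1 ^ 4 : MvPolynomial (Fin 3) k)}) :
    ∃ x : (vanishingIdeal (⟨closure (Set.range (ιQ k)), isClosed_closure⟩ : Closeds (P3 k))).subscheme,
      (vanishingIdeal (⟨closure (Set.range (ιQ k)), isClosed_closure⟩ : Closeds (P3 k))).subschemeι x = u (o k) := by
  have hmem : u (o k) ∈ Set.range (vanishingIdeal (⟨closure (Set.range (ιQ k)), isClosed_closure⟩ : Closeds (P3 k))).subschemeι := by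
    rw [range_subschemeι, Scheme.IdealSheafData.coe_support_vanishingIdeal]
    exact subset_closure (chart_o_mem_range k hu)
  exact hmem

/-- **`Γ₀` is NOT regular over `u(o)`** for a chart `u : Spec k[X] → ℙ³` with `u⁻¹ H = V(z² + x⁴ + y⁴)`: a regular stalk would make
`k[x,y,z]_{𝔪₀}/(z² + x⁴ + y⁴)` regular (`isRegularLocalRing_localization_quotient_of_chart`), contradicting stub-4's
`not_isRegularLocalRing_origin` (`f ∈ 𝔪₀²`). [OURS · (P)/(TC) input «x non-regular»] [cite: Matsumura1987, Thm. 14.2] -/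
theorem not_isRegularLocalRing_Γ₀ [IsAlgClosed k] (h2 : (2 : k) ≠ 0)
    {u : Spec (CommRingCat.of (MvPolynomial (Fin 3) k)) ⟶ P3 k} [IsOpenImmersion u]
    (hu : u ⁻¹' Set.range (ιQ k) = PrimeSpectrum.zeroLocus {(X 2 ^ 2 + X 0 ^ 4 + X 1 ^ 4 : MvPolynomial (Fin 3) k)})
    (x : (vanishingIdeal (⟨closure (Set.range (ιQ k)), isClosed_closure⟩ : Closeds (P3 k))).subscheme)
    (hx : (vanishingIdeal (⟨closure (Set.range (ιQ k)), isClosed_closure⟩ : Closeds (P3 k))).subschemeι x = u (o k)) :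
    ¬ IsRegularLocalRing ((vanishingIdeal (⟨closure (Set.range (ιQ k)), isClosed_closure⟩ : Closeds (P3 k))).subscheme.presheaf.stalk x) := by
  intro hreg
  haveI := isIntegral_Γ₀ k h2
  have hIc : (vanishingIdeal (⟨closure (Set.range (ιQ k)), isClosed_closure⟩ : Closeds (P3 k))).subschemeι.ker.comap u =
      affineBlowup.idealSheaf (Ideal.span {(X 2 ^ 2 + X 0 ^ 4 + X 1 ^ 4 : MvPolynomial (Fin 3) k)}) := by
    rw [ker_subschemeι]
    have hcl : (⟨closure (Set.range (ιQ k)), isClosed_closure⟩ : Closeds (P3 k)) = ⟨Set.range (ιQ k), isClosed_range_ι k⟩ :=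
      Closeds.ext (closure_range_ι k)
    rw [hcl]
    exact comap_vanishingIdeal_range_of_preimage k hu (SpecimenQuartic.radical_span_fSing k h2)
  letI := SpecimenQuartic.isPrime_origin k
  have h := isRegularLocalRing_localization_quotient_of_chart
    (vanishingIdeal (⟨closure (Set.range (ιQ k)), isClosed_closure⟩ : Closeds (P3 k))).subschemeι u
    (Ideal.span {(X 2 ^ 2 + X 0 ^ 4 + X 1 ^ 4 : MvPolynomial (Fin 3) k)}) hIc (PointBlowup.originIdeal 2 k)
    (by rw [Ideal.span_le, Set.singleton_subset_iff]; exact fQ_mem_originIdeal k) hx hreg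
  rw [Ideal.map_span, Set.image_singleton] at h
  exact SpecimenQuartic.not_isRegularLocalRing_origin k h

end SpecimenQuarticTcDelta

end Summit.ResolutionOfSingularities.ResolutionOfSingularities.Cruxes.EquisingularLiftNat.Sections
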